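import Literature.MathematicalPhysics.QuantumFieldTheory.OSTimeLorentzInfinitesimal
import Mathlib.MeasureTheory.Measure.Lebesgue.EqHaar
import HarnessLib

/-!
# The time swap: from Euclidean-time weights to Minkowski-time integrals

Topic `Literature/MathematicalPhysics/QuantumFieldTheory`; second support file (everything proved)
for the discharge of (B) `OS1973_lorentzInvariant_of_timeContinuation` of
`Literature.MathematicalPhysics.QuantumFieldTheory.OSTimeContinuation` (Osterwalder–Schrader I
(1973), §4.2). The first file (`OSTimeLorentzInfinitesimal`) proves, for every Schwartz `G_E` with
compact support in the time-ordered region and every real `u ∈ ℝⁿ`, the identity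
`∫ 𝔚((u_k + i x⁰_k, x⃗_k)_k) (Ξ_u G_E)(x) dx = 0` — the rotation identity of E1 continued to
real time shifts. Here it is turned into a statement about the **slices**
`A_τ(F) = ∫ 𝔚(y + iτ̂) F(y) dy` (`τ̂ = timeLift τ`, `τ` in the time cone) of `𝔚` against Minkowski
test functions: for a compactly supported Schwartz `G` on `(ℝ^{1+d})ⁿ` and a smooth real weight
`h` compactly supported in the time cone, apply the identity at `u` to the Euclidean test function
`x ↦ h(x⁰) G(sw_u x)` (`sw_u x` = `x` with its times replaced by `u`, `swapTimes`) and integrate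
over `u`; the linear involution `(u, x) ↦ (x⁰, sw_u x)` of `ℝⁿ × (ℝ^{1+d})ⁿ` (`swapMap`) preserves
Lebesgue measure (`|det| = 1`), and transports the double integral to

  `∫ dτ { h(τ) A_τ(∑ₖ (y⁰_k + iτ_k) ∂_{e_i,k} G) − i ∑ₖ (∂_k h)(τ) A_τ(yⁱ_k G) } = 0`

(`integral_weight_slices_eq_zero`). The third file integrates by parts in `τ` and concludes.

## References

* K. Osterwalder, R. Schrader, *Axioms for Euclidean Green's functions*, Comm. Math. Phys. 31
  (1973) 83–112, §4.2, eqs. (4.14)–(4.17). [OsterwalderSchraderCMP1973]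
-/

noncomputable section

open MeasureTheory Filter Set Metric Complex
open scoped Topology SchwartzMap LineDeriv
open Literature.MathematicalPhysics.QuantumLattice Literature.Analysis.FunctionSpaces

namespace Literature.MathematicalPhysics.QuantumFieldTheory

variable {d n : ℕ}

/-! ### Times, spatial parts, and the replacement of times -/

/-- The times `(x⁰_k)_k` of a configuration, a continuous linear map. [folklore] -/
def timesCLM : (Fin n → SpaceTime d) →L[ℝ] (Fin n → ℝ) :=
  ContinuousLinearMap.pi fun k =>
    (EuclideanSpace.proj (0 : Fin (d + 1))).comp (ContinuousLinearMap.proj k)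

/-- Components of `timesCLM`. [folklore] -/
@[simp] theorem timesCLM_apply (x : Fin n → SpaceTime d) (k : Fin n) :
    timesCLM x k = x k 0 := rfl

/-- The configuration with the times set to zero, `(0, x⃗_k)_k`, a continuous linear map. [folklore] -/
def spatialCLM : (Fin n → SpaceTime d) →L[ℝ] (Fin n → SpaceTime d) :=
  ContinuousLinearMap.pi fun k =>
    (ContinuousLinearMap.id ℝ (SpaceTime d) -
      (EuclideanSpace.proj (0 : Fin (d + 1))).smulRight (e₀ d)).comp (ContinuousLinearMap.proj k)

/-- Components of `spatialCLM`: `(spatialCLM x)_k = x_k − x⁰_k e₀`. [folklore] -/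
theorem spatialCLM_apply (x : Fin n → SpaceTime d) (k : Fin n) :
    spatialCLM x k = x k - (x k 0) • e₀ d := rfl

/-- Time components of `spatialCLM` vanish. [folklore] -/
@[simp] theorem spatialCLM_apply_zero (x : Fin n → SpaceTime d) (k : Fin n) :
    spatialCLM x k 0 = 0 := by
  simp [spatialCLM_apply]

/-- Spatial components of `spatialCLM` are those of `x`. [folklore] -/
@[simp] theorem spatialCLM_apply_succ (x : Fin n → SpaceTime d) (k : Fin n) (j : Fin d) :
    spatialCLM x k j.succ = x k j.succ := by
  simp [spatialCLM_apply, Fin.succ_ne_zero]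

/-- **Replacing the times**: `(swapTimes u x)_k = (u_k, x⃗_k)`. [folklore] -/
def swapTimes (u : Fin n → ℝ) (x : Fin n → SpaceTime d) : Fin n → SpaceTime d :=
  spatialCLM x + timeLift u

/-- Time components of `swapTimes`. [folklore] -/
@[simp] theorem swapTimes_apply_zero (u : Fin n → ℝ) (x : Fin n → SpaceTime d) (k : Fin n) :
    swapTimes u x k 0 = u k := by
  simp [swapTimes]

/-- Spatial components of `swapTimes`. [folklore] -/
@[simp] theorem swapTimes_apply_succ (u : Fin n → ℝ) (x : Fin n → SpaceTime d) (k : Fin n)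
    (j : Fin d) : swapTimes u x k j.succ = x k j.succ := by
  simp [swapTimes]

/-- Replacing the times twice. [folklore] -/
theorem swapTimes_swapTimes (u v : Fin n → ℝ) (x : Fin n → SpaceTime d) :
    swapTimes u (swapTimes v x) = swapTimes u x := by
  funext k; ext μ
  refine Fin.cases ?_ (fun j => ?_) μ <;> simp

/-- Replacing the times by themselves. [folklore] -/
theorem swapTimes_timesCLM (x : Fin n → SpaceTime d) : swapTimes (timesCLM x) x = x := by
  funext k; ext μ
  refine Fin.cases ?_ (fun j => ?_) μ <;> simp

/-- The times of `swapTimes u x` are `u`. [folklore] -/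
@[simp] theorem timesCLM_swapTimes (u : Fin n → ℝ) (x : Fin n → SpaceTime d) :
    timesCLM (swapTimes u x) = u := by
  funext k; simp

/-- `timeLift` is additive. [folklore] -/
theorem timeLift_add (s t : Fin n → ℝ) :
    (timeLift (s + t) : Fin n → SpaceTime d) = timeLift s + timeLift t := by
  funext k; simp [timeLift, add_smul]

/-- `timeLift` is homogeneous. [folklore] -/
theorem timeLift_smul (c : ℝ) (s : Fin n → ℝ) :
    (timeLift (c • s) : Fin n → SpaceTime d) = c • timeLift s := by
  funext k; simp [timeLift, mul_smul]

/-- `timeLift (e_k) = e_{0,k}`. [folklore] -/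
theorem timeLift_single (k : Fin n) :
    (timeLift (Pi.single k (1 : ℝ)) : Fin n → SpaceTime d) = unitDir k (0 : Fin (d + 1)) := by
  funext j; ext μ
  rw [unitDir_apply]
  refine Fin.cases ?_ (fun i => ?_) μ
  · by_cases hjk : j = k
    · subst hjk; simp [timeLift]
    · simp [timeLift, hjk]
  · simp [timeLift, Fin.succ_ne_zero]

/-- `timeLift τ` is purely temporal. [folklore] -/
theorem timeLift_apply_succ_eq_zero (τ : Fin n → ℝ) (k : Fin n) (j : Fin d) :
    (timeLift τ : Fin n → SpaceTime d) k j.succ = 0 := timeLift_apply_succ τ k j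

/-- The point `y + i τ̂` of the time tube: complex times `y⁰_k + i τ_k`, real space. In particular
`timeShiftC u x = swapTimes u x + i (x⁰)^`. [folklore] -/
theorem timeShiftC_eq_rayC (u : Fin n → ℝ) (x : Fin n → SpaceTime d) :
    timeShiftC (fun k => (u k : ℂ)) x = rayC (swapTimes u x) (timeLift (timesCLM x)) I := by
  funext k μ
  refine Fin.cases ?_ (fun j => ?_) μ
  · simp only [timeShiftC_apply_zero, rayC_apply, Pi.add_apply, Pi.smul_apply, complexifyPoint_apply,
      swapTimes_apply_zero, timeLift_apply_zero, timesCLM_apply, smul_eq_mul]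
  · simp [rayC_apply, complexifyPoint_apply]

/-! ### The time cone -/

variable (n) in
/-- The **time cone** `C₊ = {τ ∈ ℝⁿ | 0 < τ₀ < τ₁ < ⋯ < τ_{n-1}}` (positive successive
differences): the Euclidean times of time-ordered configurations, the imaginary times of the
time tube. [folklore] -/
def timeCone : Set (Fin n → ℝ) := {τ | ∀ k, 0 < succDiff τ k}

/-- Membership in the time cone. [folklore] -/
@[simp] theorem mem_timeCone_iff (τ : Fin n → ℝ) : τ ∈ timeCone n ↔ ∀ k, 0 < succDiff τ k :=
  Iff.rfl

/-- `succDiff` is continuous on `ℝⁿ`. [folklore] -/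
theorem continuous_succDiff_real (k : Fin n) : Continuous fun τ : Fin n → ℝ => succDiff τ k := by
  cases n with
  | zero => exact k.elim0
  | succ m =>
    refine Fin.cases ?_ (fun i => ?_) k
    · simp only [succDiff_zero]; exact continuous_apply _
    · simp only [succDiff_succ]; exact (continuous_apply _).sub (continuous_apply _)

/-- The time cone is open. [folklore] -/
theorem isOpen_timeCone : IsOpen (timeCone n) := by
  simp only [timeCone, setOf_forall]
  exact isOpen_iInter_of_finite fun k => isOpen_lt continuous_const (continuous_succDiff_real k)

/-- `timeLift τ` lies in the temporal cone iff `τ` lies in the time cone. [folklore] -/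
theorem timeLift_mem_temporalCone_iff (τ : Fin n → ℝ) :
    (timeLift τ : Fin n → SpaceTime d) ∈ temporalCone d n ↔ τ ∈ timeCone n := by
  rw [mem_temporalCone_iff, mem_timeCone_iff]
  simp

/-- The times of a time-ordered configuration lie in the time cone. [folklore] -/
theorem timesCLM_mem_timeCone {x : Fin n → SpaceTime d} (hx : x ∈ timeOrderedRegion d n) :
    timesCLM x ∈ timeCone n := fun k => succDiff_pos_of_mem_timeOrderedRegion hx k

/-- Partial sums of successive differences: `τ_k = ∑_{j ≤ k} succDiff τ j`... in the form needed
here: if all successive differences are positive then all `τ_k` are positive and increasing. [folklore] -/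
theorem pos_and_strictMono_of_succDiff_pos {τ : Fin n → ℝ} (h : ∀ k, 0 < succDiff τ k) :
    (∀ k, 0 < τ k) ∧ StrictMono τ := by
  cases n with
  | zero => exact ⟨fun k => k.elim0, Subsingleton.strictMono _⟩
  | succ m =>
    have hmono : StrictMono τ := by
      rw [Fin.strictMono_iff_lt_succ]
      intro i
      have := h i.succ
      rw [succDiff_succ] at this
      exact sub_pos.1 this
    refine ⟨fun k => ?_, hmono⟩
    have h0 : 0 < τ 0 := by have := h 0; rwa [succDiff_zero] at this
    exact lt_of_lt_of_le h0 (hmono.monotone (Fin.zero_le k))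

/-- A configuration whose times lie in the time cone is time-ordered. [folklore] -/
theorem mem_timeOrderedRegion_of_timesCLM_mem {x : Fin n → SpaceTime d}
    (hx : timesCLM x ∈ timeCone n) : x ∈ timeOrderedRegion d n := by
  obtain ⟨hpos, hmono⟩ := pos_and_strictMono_of_succDiff_pos hx
  exact ⟨fun i => hpos i, hmono⟩

/-! ### The Euclidean test function `x ↦ h(x⁰) G(sw_u x)` -/

section EuclTest

variable (h : (Fin n → ℝ) → ℝ) (G : 𝓢((Fin n → SpaceTime d), ℂ)) (u : Fin n → ℝ)

/-- The function `x ↦ h(x⁰) G(sw_u x)`. [folklore] -/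
def euclTestFn (x : Fin n → SpaceTime d) : ℂ := (h (timesCLM x) : ℂ) * G (swapTimes u x)

variable {h G}

/-- `x ↦ h(x⁰) G(sw_u x)` is smooth for smooth `h`. [folklore] -/
theorem contDiff_euclTestFn (hh : ContDiff ℝ (⊤ : ℕ∞) h) : ContDiff ℝ (⊤ : ℕ∞) (euclTestFn h G u) := by
  unfold euclTestFn swapTimes
  refine (ofRealCLM.contDiff.comp (hh.comp (timesCLM (d := d) (n := n)).contDiff)).mul ?_
  exact (G.smooth ⊤).comp ((spatialCLM (d := d) (n := n)).contDiff.add contDiff_const)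

/-- Norm control: `‖x_k‖ ≤ |x⁰_k| + ‖x_k − x⁰_k e₀‖`. [folklore] -/
theorem norm_le_timesCLM_add_spatialCLM (x : Fin n → SpaceTime d) :
    ‖x‖ ≤ ‖timesCLM x‖ + ‖spatialCLM x‖ := by
  refine (pi_norm_le_iff_of_nonneg (by positivity)).2 fun k => ?_
  have hk : x k = (x k 0) • e₀ d + spatialCLM x k := by
    rw [spatialCLM_apply]; abel
  calc ‖x k‖ = ‖(x k 0) • e₀ d + spatialCLM x k‖ := by rw [← hk]
    _ ≤ ‖(x k 0) • e₀ d‖ + ‖spatialCLM x k‖ := norm_add_le _ _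
    _ = |x k 0| + ‖spatialCLM x k‖ := by
        rw [norm_smul, e₀, PiLp.norm_single, norm_one, mul_one, Real.norm_eq_abs]
    _ ≤ ‖timesCLM x‖ + ‖spatialCLM x‖ := by
        refine add_le_add ?_ (norm_le_pi_norm _ k)
        have := norm_le_pi_norm (timesCLM x) k
        rwa [timesCLM_apply, Real.norm_eq_abs] at this

/-- `x ↦ h(x⁰) G(sw_u x)` has compact support if `h` and `G` have. [folklore] -/
theorem hasCompactSupport_euclTestFn (hh : HasCompactSupport h)
    (hG : HasCompactSupport (G : (Fin n → SpaceTime d) → ℂ)) :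
    HasCompactSupport (euclTestFn h G u) := by
  obtain ⟨Rh, hRh⟩ := hh.isCompact.isBounded.subset_closedBall 0
  obtain ⟨RG, hRG⟩ := hG.isCompact.isBounded.subset_closedBall 0
  refine HasCompactSupport.intro (isCompact_closedBall (0 : Fin n → SpaceTime d)
    (Rh + (RG + ‖(timeLift u : Fin n → SpaceTime d)‖))) fun x hx => ?_
  rw [mem_closedBall_zero_iff, not_le] at hx
  unfold euclTestFn
  by_cases h1 : timesCLM x ∈ tsupport h
  · have h1' : ‖timesCLM x‖ ≤ Rh := mem_closedBall_zero_iff.1 (hRh h1)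
    have h2 : swapTimes u x ∉ tsupport (G : (Fin n → SpaceTime d) → ℂ) := by
      intro h2
      have h2' : ‖swapTimes u x‖ ≤ RG := mem_closedBall_zero_iff.1 (hRG h2)
      have h3 : ‖spatialCLM x‖ ≤ RG + ‖(timeLift u : Fin n → SpaceTime d)‖ := by
        have : spatialCLM x = swapTimes u x - timeLift u := by simp [swapTimes]
        rw [this]
        exact (norm_sub_le _ _).trans (by linarith)
      have := norm_le_timesCLM_add_spatialCLM x
      linarith
    rw [image_eq_zero_of_notMem_tsupport h2, mul_zero]
  · rw [image_eq_zero_of_notMem_tsupport h1, ofReal_zero, zero_mul]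

/-- `x ↦ h(x⁰) G(sw_u x)` as a Schwartz function. [folklore] -/
def euclTest (hh : ContDiff ℝ (⊤ : ℕ∞) h) (hhc : HasCompactSupport h)
    (hG : HasCompactSupport (G : (Fin n → SpaceTime d) → ℂ)) : 𝓢((Fin n → SpaceTime d), ℂ) :=
  (hasCompactSupport_euclTestFn u hhc hG).toSchwartzMap (contDiff_euclTestFn u hh)

/-- Values of `euclTest`. [folklore] -/
@[simp] theorem euclTest_apply (hh : ContDiff ℝ (⊤ : ℕ∞) h) (hhc : HasCompactSupport h)
    (hG : HasCompactSupport (G : (Fin n → SpaceTime d) → ℂ)) (x : Fin n → SpaceTime d) :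
    euclTest u hh hhc hG x = (h (timesCLM x) : ℂ) * G (swapTimes u x) := rfl

/-- The support of `x ↦ h(x⁰) G(sw_u x)` projects into the support of `h`. [folklore] -/
theorem timesCLM_mem_tsupport_of_mem_tsupport_euclTestFn {x : Fin n → SpaceTime d}
    (hx : x ∈ tsupport (euclTestFn h G u)) : timesCLM x ∈ tsupport h := by
  have hcl : IsClosed ((timesCLM : (Fin n → SpaceTime d) → Fin n → ℝ) ⁻¹' tsupport h) :=
    (isClosed_tsupport h).preimage timesCLM.continuous
  refine (closure_minimal (fun y hy => ?_) hcl) hx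
  show timesCLM y ∈ tsupport h
  by_contra hy'
  exact hy (by simp [euclTestFn, image_eq_zero_of_notMem_tsupport hy'])

/-- If `h` is supported in the time cone then `x ↦ h(x⁰) G(sw_u x)` is supported in the time-ordered
region. [folklore] -/
theorem tsupport_euclTestFn_subset (hh : tsupport h ⊆ timeCone n) :
    tsupport (euclTestFn h G u) ⊆ timeOrderedRegion d n := fun _ hx =>
  mem_timeOrderedRegion_of_timesCLM_mem (hh (timesCLM_mem_tsupport_of_mem_tsupport_euclTestFn u hx))

/-- **Spatial derivatives of `x ↦ h(x⁰) G(sw_u x)`**: `∂_{e_i,k}` falls on `G` only. [folklore] -/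
theorem fderiv_euclTestFn_unitDir_succ (hh : ContDiff ℝ (⊤ : ℕ∞) h) (x : Fin n → SpaceTime d)
    (k : Fin n) (i : Fin d) :
    fderiv ℝ (euclTestFn h G u) x (unitDir k i.succ) =
      (h (timesCLM x) : ℂ) * ∂_{unitDir k i.succ} G (swapTimes u x) := by
  -- restrict to the line `x + t e_{i,k}`: the times do not move, the spatial part moves by `t e_{i,k}`
  have hdiff : DifferentiableAt ℝ (euclTestFn h G u) x :=
    ((contDiff_euclTestFn u hh).differentiable (by simp)) x
  have hline : HasLineDerivAt ℝ (euclTestFn h G u)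
      ((h (timesCLM x) : ℂ) * ∂_{unitDir k i.succ} G (swapTimes u x)) x (unitDir k i.succ) := by
    have ht : ∀ t : ℝ, timesCLM (x + t • unitDir k i.succ) = timesCLM x := fun t => by
      funext j
      simp [unitDir_apply, (Fin.succ_ne_zero i).symm]
    have hs : ∀ t : ℝ, swapTimes u (x + t • unitDir k i.succ) = swapTimes u x + t • unitDir k i.succ := by
      intro t
      funext j; ext μ
      refine Fin.cases ?_ (fun l => ?_) μ
      · simp [unitDir_apply, (Fin.succ_ne_zero i).symm]
      · simp [unitDir_apply]
    show HasDerivAt (fun t : ℝ => euclTestFn h G u (x + t • unitDir k i.succ)) _ 0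
    have hfun : (fun t : ℝ => euclTestFn h G u (x + t • unitDir k i.succ)) =
        fun t => (h (timesCLM x) : ℂ) * G (swapTimes u x + t • unitDir k i.succ) := by
      funext t; simp only [euclTestFn, ht, hs]
    rw [hfun]
    have hG' : HasDerivAt (fun t : ℝ => G (swapTimes u x + t • unitDir k i.succ))
        (fderiv ℝ (G : (Fin n → SpaceTime d) → ℂ) (swapTimes u x) (unitDir k i.succ)) 0 := by
      have hl : HasDerivAt (fun t : ℝ => swapTimes u x + t • unitDir k i.succ) (unitDir k i.succ) 0 := by
        simpa using ((hasDerivAt_id (0 : ℝ)).smul_const (unitDir (d := d) k i.succ)).const_add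
          (swapTimes u x)
      have h := (G.hasFDerivAt (swapTimes u x)).comp_hasDerivAt_of_eq 0 hl (by simp)
      exact h.congr_of_eventuallyEq (Eventually.of_forall fun t => rfl)
    simpa [SchwartzMap.lineDerivOp_apply_eq_fderiv] using hG'.const_mul (h (timesCLM x) : ℂ)
  rw [← hdiff.lineDeriv_eq_fderiv]
  exact hline.lineDeriv

/-- **Time derivatives of `x ↦ h(x⁰) G(sw_u x)`**: `∂_{e₀,k}` falls on `h` only. [folklore] -/
theorem fderiv_euclTestFn_unitDir_zero (hh : ContDiff ℝ (⊤ : ℕ∞) h) (x : Fin n → SpaceTime d)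
    (k : Fin n) :
    fderiv ℝ (euclTestFn h G u) x (unitDir k (0 : Fin (d + 1))) =
      (fderiv ℝ h (timesCLM x) (Pi.single k 1) : ℂ) * G (swapTimes u x) := by
  have hdiff : DifferentiableAt ℝ (euclTestFn h G u) x :=
    ((contDiff_euclTestFn u hh).differentiable (by simp)) x
  have hline : HasLineDerivAt ℝ (euclTestFn h G u)
      ((fderiv ℝ h (timesCLM x) (Pi.single k 1) : ℂ) * G (swapTimes u x)) x
      (unitDir k (0 : Fin (d + 1))) := by
    have ht : ∀ t : ℝ, timesCLM (x + t • unitDir k (0 : Fin (d + 1))) =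
        timesCLM x + t • Pi.single k (1 : ℝ) := fun t => by
      funext j
      simp [unitDir_apply, Pi.single_apply]
    have hs : ∀ t : ℝ, swapTimes u (x + t • unitDir k (0 : Fin (d + 1))) = swapTimes u x := by
      intro t
      funext j; ext μ
      refine Fin.cases ?_ (fun l => ?_) μ
      · simp
      · simp [unitDir_apply, Fin.succ_ne_zero]
    show HasDerivAt (fun t : ℝ => euclTestFn h G u (x + t • unitDir k (0 : Fin (d + 1)))) _ 0
    have hfun : (fun t : ℝ => euclTestFn h G u (x + t • unitDir k (0 : Fin (d + 1)))) =
        fun t => (h (timesCLM x + t • Pi.single k (1 : ℝ)) : ℂ) * G (swapTimes u x) := by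
      funext t; simp only [euclTestFn, ht, hs]
    rw [hfun]
    have hh' : HasDerivAt (fun t : ℝ => (h (timesCLM x + t • Pi.single k (1 : ℝ)) : ℂ))
        ((fderiv ℝ h (timesCLM x) (Pi.single k 1) : ℂ)) 0 := by
      have hl : HasDerivAt (fun t : ℝ => timesCLM x + t • Pi.single k (1 : ℝ)) (Pi.single k 1) 0 := by
        simpa using ((hasDerivAt_id (0 : ℝ)).smul_const (Pi.single k (1 : ℝ))).const_add (timesCLM x)
      have hd : HasFDerivAt h (fderiv ℝ h (timesCLM x)) (timesCLM x) :=
        ((hh.differentiable (by simp)) _).hasFDerivAt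
      have h2 := hd.comp_hasDerivAt_of_eq 0 hl (by simp)
      have h3 := ofRealCLM.hasFDerivAt.comp_hasDerivAt 0 h2
      exact h3.congr_of_eventuallyEq (Eventually.of_forall fun t => rfl)
    simpa using hh'.mul_const (G (swapTimes u x))
  rw [← hdiff.lineDeriv_eq_fderiv]
  exact hline.lineDeriv

end EuclTest

/-! ### The swap involution of `ℝⁿ × (ℝ^{1+d})ⁿ` and its measure preservation -/

section Swap

/-- **The swap** `(u, x) ↦ (x⁰, sw_u x)`: exchange the real `n`-tuple with the times of the
configuration. [folklore] -/
def swapMap (p : (Fin n → ℝ) × (Fin n → SpaceTime d)) : (Fin n → ℝ) × (Fin n → SpaceTime d) :=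
  (timesCLM p.2, swapTimes p.1 p.2)

/-- First component of the swap. [folklore] -/
@[simp] theorem swapMap_fst (p : (Fin n → ℝ) × (Fin n → SpaceTime d)) : (swapMap p).1 = timesCLM p.2 :=
  rfl

/-- Second component of the swap. [folklore] -/
@[simp] theorem swapMap_snd (p : (Fin n → ℝ) × (Fin n → SpaceTime d)) :
    (swapMap p).2 = swapTimes p.1 p.2 := rfl

/-- The swap is an involution. [folklore] -/
theorem swapMap_swapMap (p : (Fin n → ℝ) × (Fin n → SpaceTime d)) : swapMap (swapMap p) = p := by
  obtain ⟨u, x⟩ := p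
  refine Prod.ext ?_ ?_
  · simp [swapMap]
  · simp only [swapMap]
    rw [swapTimes_swapTimes, swapTimes_timesCLM]

/-- The swap as a linear map. [folklore] -/
def swapLin : ((Fin n → ℝ) × (Fin n → SpaceTime d)) →ₗ[ℝ] ((Fin n → ℝ) × (Fin n → SpaceTime d)) where
  toFun := swapMap
  map_add' p q := by
    refine Prod.ext ?_ ?_
    · simp [swapMap]
    · simp only [swapMap, Prod.snd_add, Prod.fst_add, swapTimes, map_add, timeLift_add]
      abel
  map_smul' c p := by
    refine Prod.ext ?_ ?_
    · simp [swapMap]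
    · simp only [swapMap, Prod.smul_snd, Prod.smul_fst, swapTimes, map_smul, timeLift_smul,
        RingHom.id_apply, smul_add]

/-- The swap as a linear map acts as `swapMap`. [folklore] -/
@[simp] theorem swapLin_apply (p : (Fin n → ℝ) × (Fin n → SpaceTime d)) : swapLin p = swapMap p := rfl

/-- The swap as a continuous linear automorphism (it is its own inverse). [folklore] -/
def swapCLE : ((Fin n → ℝ) × (Fin n → SpaceTime d)) ≃L[ℝ] ((Fin n → ℝ) × (Fin n → SpaceTime d)) :=
  LinearEquiv.toContinuousLinearEquiv
    { (swapLin : ((Fin n → ℝ) × (Fin n → SpaceTime d)) →ₗ[ℝ] _) with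
      invFun := swapMap
      left_inv := swapMap_swapMap
      right_inv := swapMap_swapMap }

/-- `swapCLE` acts as `swapMap`. [folklore] -/
@[simp] theorem swapCLE_apply (p : (Fin n → ℝ) × (Fin n → SpaceTime d)) : swapCLE p = swapMap p := rfl

/-- The determinant of the swap is `±1` (it squares to the identity). [folklore] -/
theorem abs_det_swapLin : |LinearMap.det (swapLin : ((Fin n → ℝ) × (Fin n → SpaceTime d)) →ₗ[ℝ] _)| = 1 := by
  have hcomp : (swapLin : ((Fin n → ℝ) × (Fin n → SpaceTime d)) →ₗ[ℝ] _).comp swapLin = LinearMap.id := by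
    ext p <;> simp [swapMap_swapMap]
  have hdet := congrArg LinearMap.det hcomp
  rw [LinearMap.det_comp, LinearMap.det_id] at hdet
  have hsq : |LinearMap.det (swapLin : ((Fin n → ℝ) × (Fin n → SpaceTime d)) →ₗ[ℝ] _)| ^ 2 = 1 := by
    rw [sq_abs, sq, hdet]
  exact (pow_eq_one_iff_of_nonneg (abs_nonneg _) two_ne_zero).1 hsq

/-- **The swap preserves Lebesgue measure** (a linear automorphism with `|det| = 1`). [folklore] -/
theorem measurePreserving_swapMap :
    MeasurePreserving (swapMap : (Fin n → ℝ) × (Fin n → SpaceTime d) → _) volume volume := by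
  haveI : (volume : Measure ((Fin n → ℝ) × (Fin n → SpaceTime d))).IsAddHaarMeasure :=
    Measure.prod.instIsAddHaarMeasure _ _
  have hdet := abs_det_swapLin (d := d) (n := n)
  have hne : LinearMap.det (swapLin : ((Fin n → ℝ) × (Fin n → SpaceTime d)) →ₗ[ℝ] _) ≠ 0 := by
    intro h0; rw [h0, abs_zero] at hdet; exact zero_ne_one hdet
  refine ⟨(swapCLE (d := d) (n := n)).continuous.measurable, ?_⟩
  have h := Measure.map_linearMap_addHaar_eq_smul_addHaar
    (μ := (volume : Measure ((Fin n → ℝ) × (Fin n → SpaceTime d)))) hne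
  have hcoe : ((swapLin : ((Fin n → ℝ) × (Fin n → SpaceTime d)) →ₗ[ℝ] _) :
      (Fin n → ℝ) × (Fin n → SpaceTime d) → _) = swapMap := rfl
  rw [hcoe] at h
  rw [h, abs_inv, hdet, inv_one, ENNReal.ofReal_one, one_smul]

/-- The swap is a measurable embedding (it is a homeomorphism). [folklore] -/
theorem measurableEmbedding_swapMap :
    MeasurableEmbedding (swapMap : (Fin n → ℝ) × (Fin n → SpaceTime d) → _) :=
  (swapCLE (d := d) (n := n)).toHomeomorph.measurableEmbedding

end Swap

/-! ### From the identity at real time shifts to the weighted slice identity -/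

section Slices

variable {S : SchwingerFamily (EuclideanSpace ℝ (Fin (d + 1)))} {𝔚 : (Fin n → Fin (d + 1) → ℂ) → ℂ}
  {C : ℝ} {N : ℕ}

/-- The test function `∑ₖ (y⁰_k + iτ_k) ∂_{e_i,k} G` paired with the slice at height `τ` in the
key identity (its value at `y`). [folklore] -/
def pFn (i : Fin d) (τ : Fin n → ℝ) (G : 𝓢((Fin n → SpaceTime d), ℂ)) (y : Fin n → SpaceTime d) : ℂ :=
  ∑ k, ((y k 0 : ℂ) + I * (τ k : ℂ)) * ∂_{unitDir k i.succ} G y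

/-- `(τ, y) ↦ y + iτ̂` is continuous. [folklore] -/
theorem continuous_rayC_timeLift :
    Continuous fun p : (Fin n → ℝ) × (Fin n → SpaceTime d) => rayC p.2 (timeLift p.1) I := by
  unfold rayC
  refine (continuous_cpxConfig.comp continuous_snd).add ?_
  refine (continuous_cpxConfig.comp ?_).const_smul I
  exact continuous_pi fun k => (continuous_apply k).comp continuous_fst |>.smul continuous_const

/-- Slice kernels with a linear weight are polynomially bounded: for `ŷ = timeLift τ`, `τ` in a
compact subset of the time cone with constant `A`, `‖𝔚(y + iŷ) c(y)‖ ≤ A B (1 + ‖y‖)^{N+1}`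
whenever `‖c(y)‖ ≤ B (1 + ‖y‖)`. [folklore] -/
theorem norm_kernel_mul_le {A B : ℝ} (hA : 0 ≤ A) {ŷ : Fin n → SpaceTime d}
    (hle : ∀ y : Fin n → SpaceTime d, ‖𝔚 (rayC y ŷ I)‖ ≤ A * (1 + ‖y‖) ^ N)
    {c : (Fin n → SpaceTime d) → ℂ} (hc : ∀ y, ‖c y‖ ≤ B * (1 + ‖y‖)) (y : Fin n → SpaceTime d) :
    ‖𝔚 (rayC y ŷ I) * c y‖ ≤ A * B * (1 + ‖y‖) ^ (N + 1) := by
  rw [norm_mul, pow_succ]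
  have hB : 0 ≤ B * (1 + ‖y‖) := (norm_nonneg _).trans (hc y)
  calc ‖𝔚 (rayC y ŷ I)‖ * ‖c y‖ ≤ A * (1 + ‖y‖) ^ N * (B * (1 + ‖y‖)) :=
        mul_le_mul (hle y) (hc y) (norm_nonneg _) (by positivity)
    _ = A * B * ((1 + ‖y‖) ^ N * (1 + ‖y‖)) := by ring

/-- **The weighted slice identity** (Osterwalder–Schrader I (1973), §4.2, the step
(4.15) ⇒ (4.16)–(4.17) in position space). Let `𝔖ₙ` be Euclidean covariant and `𝔚` continuous on
the time tube, holomorphic in the times, of OS growth, with Euclidean restriction `𝔖ₙ` on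
time-ordered test functions. Then for every compactly supported Schwartz `G` on `(ℝ^{1+d})ⁿ`,
every spatial direction `i` and every smooth real weight `h` with compact support in the time cone,

  `∫ dτ { h(τ) ∫ 𝔚(y + iτ̂) (∑ₖ (y⁰_k + iτ_k) ∂_{e_i,k} G)(y) dy
          − i ∑ₖ (∂_k h)(τ) ∫ 𝔚(y + iτ̂) yⁱ_k G(y) dy } = 0`.

Proof: the identity of `integral_timeShiftC_mul_shiftGenFn_eq_zero` at the shift `u` for the
Euclidean test function `x ↦ h(x⁰) G(sw_u x)` (`euclTest`; its `e_{i,k}`-derivative is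
`h(x⁰) (∂_{e_i,k}G)(sw_u x)`, its `e_{0,k}`-derivative `(∂_k h)(x⁰) G(sw_u x)`), integrated over
`u ∈ ℝⁿ`, is the integral over `ℝⁿ × (ℝ^{1+d})ⁿ` of a function which, composed with the
measure-preserving swap `(u, x) ↦ (x⁰, sw_u x)`, is the integrand above (`timeShiftC_eq_rayC`);
Fubini on both sides. [cite: OsterwalderSchraderCMP1973, §4.2 eqs. (4.15)–(4.17)] -/
theorem integral_weight_slices_eq_zero (hE1 : S.IsEuclideanCovariant)
    (hGc : ContinuousOn 𝔚 (timeTube d n)) (hGh : IsTimeHolomorphicOn 𝔚 (timeTube d n))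
    (hG : ∀ z ∈ timeTube d n, ‖𝔚 z‖ ≤ C * (1 + ‖z‖) ^ N *
      (1 + ∑ k, ((succDiff (fun j => z j 0) k).im)⁻¹) ^ N)
    (hS : ∀ F : 𝓢((Fin n → EuclideanSpace ℝ (Fin (d + 1))), ℂ), IsTimeOrdered F →
      S n F = ∫ x, 𝔚 (euclideanPoint x) * F x)
    (i : Fin d) (G : 𝓢((Fin n → SpaceTime d), ℂ))
    (hGK : HasCompactSupport (G : (Fin n → SpaceTime d) → ℂ))
    {h : (Fin n → ℝ) → ℝ} (hh : ContDiff ℝ (⊤ : ℕ∞) h) (hhc : HasCompactSupport h)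
    (hhC : tsupport h ⊆ timeCone n) :
    ∫ τ : Fin n → ℝ, ((h τ : ℂ) * (∫ y, 𝔚 (rayC y (timeLift τ) I) * pFn i τ G y) -
      I * ∑ k, (fderiv ℝ h τ (Pi.single k 1) : ℂ) *
        (∫ y, 𝔚 (rayC y (timeLift τ) I) * ((y k i.succ : ℂ) * G y))) = 0 := by
  -- the integrand on `ℝⁿ × (ℝ^{1+d})ⁿ` after the swap
  set br : (Fin n → ℝ) × (Fin n → SpaceTime d) → ℂ := fun q =>
    ∑ k, (((q.2 k 0 : ℂ) + I * (q.1 k : ℂ)) * ((h q.1 : ℂ) * ∂_{unitDir k i.succ} G q.2) -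
      I * (q.2 k i.succ : ℂ) * ((fderiv ℝ h q.1 (Pi.single k 1) : ℂ) * G q.2)) with hbr
  set Gn : (Fin n → ℝ) × (Fin n → SpaceTime d) → ℂ := fun q =>
    𝔚 (rayC q.2 (timeLift q.1) I) * br q with hGn
  -- the integrand before the swap, and the identity at real time shifts
  set Fn : (Fin n → ℝ) × (Fin n → SpaceTime d) → ℂ := Gn ∘ swapMap with hFn
  have hE : ∀ u : Fin n → ℝ, ∫ x, Fn (u, x) = 0 := by
    intro u
    have h0 := integral_timeShiftC_mul_shiftGenFn_eq_zero hE1 hGc hGh hS i (euclTest u hh hhc hGK)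
      (tsupport_euclTestFn_subset u hhC) (hasCompactSupport_euclTestFn u hhc hGK) u
    rw [← h0]
    congr 1
    funext x
    simp only [hFn, hGn, hbr, Function.comp_apply, swapMap_snd, swapMap_fst, timeShiftC_eq_rayC]
    congr 1
    unfold shiftGenFn
    refine Finset.sum_congr rfl fun k _ => ?_
    have h1 : ∂_{unitDir k i.succ} (euclTest u hh hhc hGK) x =
        (h (timesCLM x) : ℂ) * ∂_{unitDir k i.succ} G (swapTimes u x) := by
      rw [SchwartzMap.lineDerivOp_apply_eq_fderiv]
      exact fderiv_euclTestFn_unitDir_succ u hh x k i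
    have h2 : ∂_{unitDir k (0 : Fin (d + 1))} (euclTest u hh hhc hGK) x =
        (fderiv ℝ h (timesCLM x) (Pi.single k 1) : ℂ) * G (swapTimes u x) := by
      rw [SchwartzMap.lineDerivOp_apply_eq_fderiv]
      exact fderiv_euclTestFn_unitDir_zero u hh x k
    rw [h1, h2]
    simp only [swapTimes_apply_zero, swapTimes_apply_succ, timesCLM_apply]
  -- growth constant on the compact set of heights `timeLift '' tsupport h`
  set Kh := tsupport h with hKh
  have hKhc : IsCompact Kh := hhc
  have hKτ : IsCompact ((fun τ => (timeLift τ : Fin n → SpaceTime d)) '' Kh) :=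
    hKhc.image (continuous_pi fun k => (continuous_apply k).smul continuous_const)
  have hKτT : (fun τ => (timeLift τ : Fin n → SpaceTime d)) '' Kh ⊆ temporalCone d n := by
    rintro _ ⟨τ, hτ, rfl⟩
    exact (timeLift_mem_temporalCone_iff τ).2 (hhC hτ)
  obtain ⟨A, hA0, hA⟩ := exists_norm_apply_rayC_I_le_of_isCompact hG hKτ hKτT
  -- bounds for `h`, `∂h`, `τ` on the support
  obtain ⟨Bh, hBh⟩ := hKhc.exists_bound_of_continuousOn (hh.continuous.continuousOn)
  have hfdc : Continuous (fderiv ℝ h) := hh.continuous_fderiv (by simp)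
  obtain ⟨Bh', hBh'⟩ := hKhc.exists_bound_of_continuousOn hfdc.continuousOn
  obtain ⟨Rτ, hRτ⟩ := hKhc.isBounded.subset_closedBall 0
  set R : ℝ := max Rτ 0 with hR
  have hR0 : 0 ≤ R := le_max_right _ _
  have hRle : ∀ τ ∈ Kh, ‖τ‖ ≤ R := fun τ hτ =>
    (mem_closedBall_zero_iff.1 (hRτ hτ)).trans (le_max_left _ _)
  -- the bracket vanishes when `τ ∉ tsupport h`
  have hbr0 : ∀ q : (Fin n → ℝ) × (Fin n → SpaceTime d), q.1 ∉ Kh → br q = 0 := by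
    intro q hq
    have h1 : h q.1 = 0 := image_eq_zero_of_notMem_tsupport hq
    have h2 : fderiv ℝ h q.1 = 0 := fderiv_of_notMem_tsupport ℝ hq
    simp [hbr, h1, h2]
  -- pointwise bound of the terms of the bracket
  set B₀ : ℝ := (max Bh 0 + max Bh' 0) * (1 + R) with hB₀
  have hB₀0 : 0 ≤ B₀ := by positivity
  have hterm : ∀ τ ∈ Kh, ∀ (y : Fin n → SpaceTime d) (k : Fin n),
      ‖((y k 0 : ℂ) + I * (τ k : ℂ)) * ((h τ : ℂ) * ∂_{unitDir k i.succ} G y) -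
        I * (y k i.succ : ℂ) * ((fderiv ℝ h τ (Pi.single k 1) : ℂ) * G y)‖ ≤
        B₀ * (1 + ‖y‖) * (‖∂_{unitDir k i.succ} G y‖ + ‖G y‖) := by
    intro τ hτ y k
    have hy0 : |y k 0| ≤ ‖y‖ := by
      have h1 : |y k 0| ≤ ‖y k‖ := by
        have := PiLp.norm_apply_le (y k) 0
        rwa [Real.norm_eq_abs] at this
      exact h1.trans (norm_le_pi_norm y k)
    have hyi : |y k i.succ| ≤ ‖y‖ := by
      have h1 : |y k i.succ| ≤ ‖y k‖ := by
        have := PiLp.norm_apply_le (y k) i.succ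
        rwa [Real.norm_eq_abs] at this
      exact h1.trans (norm_le_pi_norm y k)
    have hτk : |τ k| ≤ R := by
      have := norm_le_pi_norm τ k
      rw [Real.norm_eq_abs] at this
      exact this.trans (hRle τ hτ)
    have hhτ : ‖(h τ : ℂ)‖ ≤ max Bh 0 := by
      rw [Complex.norm_real]
      exact (hBh τ hτ).trans (le_max_left _ _)
    have hh'τ : ‖(fderiv ℝ h τ (Pi.single k 1) : ℂ)‖ ≤ max Bh' 0 := by
      rw [Complex.norm_real]
      calc ‖fderiv ℝ h τ (Pi.single k 1)‖ ≤ ‖fderiv ℝ h τ‖ * ‖(Pi.single k (1 : ℝ) : Fin n → ℝ)‖ :=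
            ContinuousLinearMap.le_opNorm _ _
        _ ≤ max Bh' 0 * 1 := by
            gcongr
            · exact (hBh' τ hτ).trans (le_max_left _ _)
            · rw [Pi.norm_single, norm_one]
        _ = max Bh' 0 := mul_one _
    have hc1 : ‖(y k 0 : ℂ) + I * (τ k : ℂ)‖ ≤ ‖y‖ + R := by
      refine (norm_add_le _ _).trans (add_le_add ?_ ?_)
      · rw [Complex.norm_real, Real.norm_eq_abs]; exact hy0
      · rw [norm_mul, Complex.norm_I, one_mul, Complex.norm_real, Real.norm_eq_abs]; exact hτk
    have hp1 : ‖((y k 0 : ℂ) + I * (τ k : ℂ)) * ((h τ : ℂ) * ∂_{unitDir k i.succ} G y)‖ ≤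
        (‖y‖ + R) * (max Bh 0 * ‖∂_{unitDir k i.succ} G y‖) := by
      rw [norm_mul, norm_mul]
      gcongr
    have hp2 : ‖I * (y k i.succ : ℂ) * ((fderiv ℝ h τ (Pi.single k 1) : ℂ) * G y)‖ ≤
        ‖y‖ * (max Bh' 0 * ‖G y‖) := by
      rw [norm_mul, norm_mul, norm_mul, Complex.norm_I, one_mul, Complex.norm_real, Real.norm_eq_abs]
      gcongr
    have hy1 : ‖y‖ + R ≤ (1 + R) * (1 + ‖y‖) := by nlinarith [norm_nonneg y]
    have hy2 : ‖y‖ ≤ (1 + R) * (1 + ‖y‖) := by nlinarith [norm_nonneg y]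
    calc _ ≤ (‖y‖ + R) * (max Bh 0 * ‖∂_{unitDir k i.succ} G y‖) + ‖y‖ * (max Bh' 0 * ‖G y‖) :=
          (norm_sub_le _ _).trans (add_le_add hp1 hp2)
      _ ≤ (1 + R) * (1 + ‖y‖) * ((max Bh 0 + max Bh' 0) * ‖∂_{unitDir k i.succ} G y‖) +
          (1 + R) * (1 + ‖y‖) * ((max Bh 0 + max Bh' 0) * ‖G y‖) := by
          gcongr
          · exact le_add_of_nonneg_right (le_max_right _ _)
          · exact le_add_of_nonneg_left (le_max_right _ _)
      _ = B₀ * (1 + ‖y‖) * (‖∂_{unitDir k i.succ} G y‖ + ‖G y‖) := by rw [hB₀]; ring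
  -- the dominating function on the product
  set b₂ : (Fin n → SpaceTime d) → ℝ := fun y =>
    ∑ k : Fin n, ((1 + ‖y‖) ^ (N + 1) * ‖∂_{unitDir k i.succ} G y‖ + (1 + ‖y‖) ^ (N + 1) * ‖G y‖)
    with hb₂
  have hb₂i : Integrable b₂ volume := by
    refine integrable_finsetSum _ fun k _ => ?_
    exact (integrable_one_add_norm_pow_mul_norm (∂_{unitDir k i.succ} G) (N + 1)).add
      (integrable_one_add_norm_pow_mul_norm G (N + 1))
  set bound : (Fin n → ℝ) × (Fin n → SpaceTime d) → ℝ := fun q =>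
    Kh.indicator (fun _ => A * B₀) q.1 * b₂ q.2 with hbound
  have hbound_int : Integrable bound volume := by
    have h1 : Integrable (Kh.indicator fun _ : Fin n → ℝ => A * B₀) volume := by
      rw [integrable_indicator_iff hKhc.isClosed.measurableSet]
      exact integrableOn_const hKhc.measure_lt_top.ne
    exact h1.mul_prod hb₂i
  have hGn_le : ∀ q, ‖Gn q‖ ≤ bound q := by
    rintro ⟨τ, y⟩
    by_cases hτ : τ ∈ Kh
    · simp only [hbound, Set.indicator_of_mem hτ]
      have hW : ‖𝔚 (rayC y (timeLift τ) I)‖ ≤ A * (1 + ‖y‖) ^ N := hA _ ⟨τ, hτ, rfl⟩ y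
      have hbrle : ‖br (τ, y)‖ ≤ ∑ k : Fin n, B₀ * (1 + ‖y‖) * (‖∂_{unitDir k i.succ} G y‖ + ‖G y‖) :=
        (norm_sum_le _ _).trans (Finset.sum_le_sum fun k _ => hterm τ hτ y k)
      calc ‖Gn (τ, y)‖ = ‖𝔚 (rayC y (timeLift τ) I)‖ * ‖br (τ, y)‖ := norm_mul _ _
        _ ≤ A * (1 + ‖y‖) ^ N * ∑ k : Fin n, B₀ * (1 + ‖y‖) * (‖∂_{unitDir k i.succ} G y‖ + ‖G y‖) :=
            mul_le_mul hW hbrle (norm_nonneg _) (by positivity)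
        _ = A * B₀ * b₂ y := by
            rw [hb₂, Finset.mul_sum, Finset.mul_sum]
            refine Finset.sum_congr rfl fun k _ => ?_
            ring
    · have : Gn (τ, y) = 0 := by simp only [hGn, hbr0 (τ, y) hτ, mul_zero]
      rw [this, norm_zero]
      simp only [hbound, Set.indicator_of_notMem hτ, zero_mul]
      exact le_rfl
  -- continuity (hence measurability) of the integrand
  have hbrc : Continuous br := by
    simp only [hbr]
    refine continuous_finsetSum _ fun k _ => ?_
    have hc : ∀ μ : Fin (d + 1), Continuous fun q : (Fin n → ℝ) × (Fin n → SpaceTime d) =>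
        ((q.2 k μ : ℝ) : ℂ) := fun μ =>
      continuous_ofReal.comp ((EuclideanSpace.proj μ).continuous.comp
        ((continuous_apply k).comp continuous_snd))
    have hτc : Continuous fun q : (Fin n → ℝ) × (Fin n → SpaceTime d) => ((q.1 k : ℝ) : ℂ) :=
      continuous_ofReal.comp ((continuous_apply k).comp continuous_fst)
    have hhq : Continuous fun q : (Fin n → ℝ) × (Fin n → SpaceTime d) => ((h q.1 : ℝ) : ℂ) :=
      continuous_ofReal.comp (hh.continuous.comp continuous_fst)
    have hh'q : Continuous fun q : (Fin n → ℝ) × (Fin n → SpaceTime d) =>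
        ((fderiv ℝ h q.1 (Pi.single k 1) : ℝ) : ℂ) :=
      continuous_ofReal.comp ((hfdc.comp continuous_fst).clm_apply continuous_const)
    have hG1 : Continuous fun q : (Fin n → ℝ) × (Fin n → SpaceTime d) => ∂_{unitDir k i.succ} G q.2 :=
      (∂_{unitDir k i.succ} G).continuous.comp continuous_snd
    have hG2 : Continuous fun q : (Fin n → ℝ) × (Fin n → SpaceTime d) => G q.2 :=
      G.continuous.comp continuous_snd
    exact (((hc 0).add (continuous_const.mul hτc)).mul (hhq.mul hG1)).sub
      ((continuous_const.mul (hc i.succ)).mul (hh'q.mul hG2))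
  have hGnc : Continuous Gn := by
    have hU : IsOpen ((timeCone n) ×ˢ (univ : Set (Fin n → SpaceTime d))) :=
      isOpen_timeCone.prod isOpen_univ
    have hWc : ContinuousOn (fun q : (Fin n → ℝ) × (Fin n → SpaceTime d) =>
        𝔚 (rayC q.2 (timeLift q.1) I)) ((timeCone n) ×ˢ univ) := by
      refine hGc.comp continuous_rayC_timeLift.continuousOn fun q hq => ?_
      exact rayC_mem_timeTube _ ((timeLift_mem_temporalCone_iff _).2 hq.1) (by simp)
    have hsupp : tsupport br ⊆ (timeCone n) ×ˢ (univ : Set (Fin n → SpaceTime d)) := by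
      have hcl : IsClosed {q : (Fin n → ℝ) × (Fin n → SpaceTime d) | q.1 ∈ Kh} :=
        hKhc.isClosed.preimage continuous_fst
      refine (closure_minimal (fun q hq => ?_) hcl).trans fun q hq => ⟨hhC hq, mem_univ _⟩
      by_contra hq'
      exact hq (hbr0 q hq')
    exact continuous_mul_of_tsupport_subset hU hWc hbrc hsupp
  have hGn_int : Integrable Gn volume :=
    hbound_int.mono' hGnc.aestronglyMeasurable (Eventually.of_forall hGn_le)
  have hFn_int : Integrable Fn volume :=
    (measurePreserving_swapMap.integrable_comp_emb measurableEmbedding_swapMap).2 hGn_int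
  -- Fubini on both sides of the swap
  have hswap : ∫ τ, ∫ y, Gn (τ, y) = (0 : ℂ) := by
    have h1 : ∫ q, Gn q = ∫ τ, ∫ y, Gn (τ, y) := integral_prod Gn hGn_int
    have h2 : ∫ q, Fn q = ∫ q, Gn q :=
      measurePreserving_swapMap.integral_comp measurableEmbedding_swapMap Gn
    have h3 : ∫ q, Fn q = ∫ u, ∫ x, Fn (u, x) := integral_prod Fn hFn_int
    rw [← h1, ← h2, h3]
    simp [hE]
  -- the inner integral
  have hinner : ∀ τ : Fin n → ℝ, ∫ y, Gn (τ, y) =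
      (h τ : ℂ) * (∫ y, 𝔚 (rayC y (timeLift τ) I) * pFn i τ G y) -
        I * ∑ k, (fderiv ℝ h τ (Pi.single k 1) : ℂ) *
          (∫ y, 𝔚 (rayC y (timeLift τ) I) * ((y k i.succ : ℂ) * G y)) := by
    intro τ
    by_cases hτ : τ ∈ timeCone n
    · have hŷ : (timeLift τ : Fin n → SpaceTime d) ∈ temporalCone d n :=
        (timeLift_mem_temporalCone_iff τ).2 hτ
      have hWc' : Continuous fun y : Fin n → SpaceTime d => 𝔚 (rayC y (timeLift τ) I) :=
        continuous_apply_rayC_I hGc hŷ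
      have hle := norm_apply_rayC_I_le hG hŷ
      set A' : ℝ := C * ((1 + ‖(timeLift τ : Fin n → SpaceTime d)‖) ^ N *
        (1 + ∑ k, (succDiff (fun j => (timeLift τ : Fin n → SpaceTime d) j 0) k)⁻¹) ^ N) with hA'
      have hA'0 : 0 ≤ A' := by
        have := (norm_nonneg _).trans (hle 0)
        simpa using this
      -- integrability of the pieces
      have hintP : ∀ k, Integrable (fun y : Fin n → SpaceTime d =>
          𝔚 (rayC y (timeLift τ) I) * (((y k 0 : ℂ) + I * (τ k : ℂ)) * ∂_{unitDir k i.succ} G y)) volume := by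
        intro k
        have h1 : Integrable (fun y : Fin n → SpaceTime d =>
            (𝔚 (rayC y (timeLift τ) I) * ((y k 0 : ℂ) + I * (τ k : ℂ))) * ∂_{unitDir k i.succ} G y) volume := by
          refine integrable_mul_of_norm_le_pow (μ := volume) ?_
            (norm_kernel_mul_le (B := 1 + |τ k|) hA'0 hle (fun y => ?_)) (∂_{unitDir k i.succ} G)
          · exact (hWc'.mul ((continuous_ofReal.comp ((EuclideanSpace.proj (0 : Fin (d + 1))).continuous.comp
              (continuous_apply k))).add continuous_const)).aestronglyMeasurable
          · have hy0 : |y k 0| ≤ ‖y‖ := by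
              have h1 : |y k 0| ≤ ‖y k‖ := by
                have := PiLp.norm_apply_le (y k) 0
                rwa [Real.norm_eq_abs] at this
              exact h1.trans (norm_le_pi_norm y k)
            calc ‖(y k 0 : ℂ) + I * (τ k : ℂ)‖ ≤ |y k 0| + |τ k| := by
                  refine (norm_add_le _ _).trans (add_le_add ?_ ?_)
                  · rw [Complex.norm_real, Real.norm_eq_abs]
                  · rw [norm_mul, Complex.norm_I, one_mul, Complex.norm_real, Real.norm_eq_abs]
              _ ≤ (1 + |τ k|) * (1 + ‖y‖) := by nlinarith [abs_nonneg (τ k), norm_nonneg y]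
        refine h1.congr (Eventually.of_forall fun y => ?_)
        simp only
        ring
      have hintQ : ∀ k, Integrable (fun y : Fin n → SpaceTime d =>
          𝔚 (rayC y (timeLift τ) I) * ((y k i.succ : ℂ) * G y)) volume := by
        intro k
        have h1 : Integrable (fun y : Fin n → SpaceTime d =>
            (𝔚 (rayC y (timeLift τ) I) * (y k i.succ : ℂ)) * G y) volume := by
          refine integrable_mul_of_norm_le_pow (μ := volume) ?_
            (norm_kernel_mul_le (B := 1) hA'0 hle (fun y => ?_)) G
          · exact (hWc'.mul (continuous_ofReal.comp ((EuclideanSpace.proj i.succ).continuous.comp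
              (continuous_apply k)))).aestronglyMeasurable
          · have h1 : |y k i.succ| ≤ ‖y k‖ := by
              have := PiLp.norm_apply_le (y k) i.succ
              rwa [Real.norm_eq_abs] at this
            rw [Complex.norm_real, Real.norm_eq_abs]
            nlinarith [h1.trans (norm_le_pi_norm y k), norm_nonneg y]
        refine h1.congr (Eventually.of_forall fun y => ?_)
        simp only
        ring
      have hintPF : Integrable (fun y : Fin n → SpaceTime d =>
          𝔚 (rayC y (timeLift τ) I) * pFn i τ G y) volume := by
        have : (fun y : Fin n → SpaceTime d => 𝔚 (rayC y (timeLift τ) I) * pFn i τ G y) =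
            fun y => ∑ k, 𝔚 (rayC y (timeLift τ) I) *
              (((y k 0 : ℂ) + I * (τ k : ℂ)) * ∂_{unitDir k i.succ} G y) := by
          funext y; simp only [pFn, Finset.mul_sum]
        rw [this]
        exact integrable_finsetSum _ fun k _ => hintP k
      -- pointwise decomposition of the integrand
      have hpt : ∀ y, Gn (τ, y) =
          (h τ : ℂ) * (𝔚 (rayC y (timeLift τ) I) * pFn i τ G y) -
            I * ∑ k, (fderiv ℝ h τ (Pi.single k 1) : ℂ) *
              (𝔚 (rayC y (timeLift τ) I) * ((y k i.succ : ℂ) * G y)) := by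
        intro y
        simp only [hGn, hbr, pFn, Finset.mul_sum, ← Finset.sum_sub_distrib]
        refine Finset.sum_congr rfl fun k _ => ?_
        ring
      rw [integral_congr_ae (Eventually.of_forall hpt)]
      rw [integral_sub (hintPF.const_mul _) ((integrable_finsetSum _ fun k _ =>
        (hintQ k).const_mul _).const_mul _)]
      rw [integral_const_mul, integral_const_mul, integral_finsetSum _ fun k _ => (hintQ k).const_mul _]
      simp_rw [integral_const_mul]
    · have hτK : τ ∉ Kh := fun hτK => hτ (hhC hτK)
      have h1 : h τ = 0 := image_eq_zero_of_notMem_tsupport hτK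
      have h2 : fderiv ℝ h τ = 0 := fderiv_of_notMem_tsupport ℝ hτK
      have h3 : ∀ y, Gn (τ, y) = 0 := fun y => by simp only [hGn, hbr0 (τ, y) hτK, mul_zero]
      simp [h1, h2, h3]
  rw [← hswap]
  exact (integral_congr_ae (Eventually.of_forall hinner)).symm

end Slices

end Literature.MathematicalPhysics.QuantumFieldTheory
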